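import Literature.Computability.FineGrained.SchoeningFourAlgorithm
import HarnessLib

/-!
# A biased-start Schöning walk for 4-SAT as a coin-string function, IV: independent tickets

Topic `Literature/Computability/FineGrained`; sequel of `SchoeningFourAlgorithm.lean` (line
`SchoeningFour*`, towards the named fact
`Literature.Computability.FineGrained.randSatExponent_four_lt_schoening`). The repetition
argument of `SchoeningCoinBound.lean` (§ "The failure probability of the whole algorithm"),
transposed from Schöning's restarts to the tickets of `run4`: tickets read disjoint coin blocks of
the fixed length `cpt + 1` (`ticket_append`), so with `R` complete tickets fitting into the `m`
coins the number of failing coin strings is at most `(2 · #{ticket fails})^R · 2^(m - R(cpt+1))`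
(`cnt_run4_false_le`), and `run4` accepts with probability at least `2/3` as soon as
`R · #{ticket succeeds} ≥ 2 · 2^cpt` (`uniformProb_run4_ge`). The per-ticket bounds
(`SchoeningFourBound.lean`, `SchoeningFourFrozen.lean`) are plugged in by the final assembly.

## References

* U. Schöning, *A probabilistic algorithm for k-SAT and constraint satisfaction problems*, Proc.
  40th FOCS (1999) 410–414, Theorem (proof: independent repetitions) [key `SchoeningFOCS1999`].
* T. Hofmeister, U. Schöning, R. Schuler, O. Watanabe, *A probabilistic 3-SAT algorithm further
  improved*, STACS 2002, LNCS 2285, 192–202, §3 (the expected number of repetitions is the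
  reciprocal of the success probability of one run) [key `HofmeisterEtAl2002`].
-/

namespace Literature.Computability.FineGrained.SchoeningFour

open _root_.Computability Complexity SchoeningCoin

variable {k : ℕ}

section Run

variable {φ : KCNF k} {d S : ℕ}

/-- One failing round: the ticket coin, a failing ticket on the next `cpt` coins, and a failing
continuation. [folklore] -/
theorem ticket_false_of_run4_cons {b : Bool} {w r : List Bool} (hw : w.length = cpt φ d S)
    (h : run4 φ d S (b :: (w ++ r)) = false) : (ticket φ d S w).1 = false ∧ run4 φ d S r = false := by
  rw [run4_cons, Bool.or_eq_false_iff] at h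
  obtain ⟨h1, h2⟩ := ticket_append φ d S w r hw
  rw [h1] at h
  refine ⟨h.1, ?_⟩
  rw [h2 h.1] at h
  exact h.2

/-- **All tickets of a failing run fail**: if `run4 r = false`, then for every block index `i` that
fits, the ticket on the coins `r[iB + 1, iB + 1 + cpt)` fails (`B = cpt + 1`), and so does the run
on the rest. [folklore] -/
theorem tickets_false_of_run4 {r : List Bool} (hr0 : run4 φ d S r = false) :
    ∀ i : ℕ, (i + 1) * (cpt φ d S + 1) ≤ r.length →
      (∀ i' ≤ i, (ticket φ d S ((r.drop (i' * (cpt φ d S + 1) + 1)).take (cpt φ d S))).1 = false) ∧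
      run4 φ d S (r.drop ((i + 1) * (cpt φ d S + 1))) = false := by
  set c := cpt φ d S with hc
  -- one block
  have step : ∀ i : ℕ, run4 φ d S (r.drop (i * (c + 1))) = false → (i + 1) * (c + 1) ≤ r.length →
      (ticket φ d S ((r.drop (i * (c + 1) + 1)).take c)).1 = false ∧
        run4 φ d S (r.drop ((i + 1) * (c + 1))) = false := by
    intro i hi hlen
    set l := r.drop (i * (c + 1)) with hl
    have hl1 : l.length = r.length - i * (c + 1) := List.length_drop
    have hlen' : c + 1 ≤ l.length := by rw [hl1, Nat.succ_mul] at *; omega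
    obtain ⟨b, l', hbl⟩ : ∃ b l', l = b :: l' := by
      cases hcase : l with
      | nil => rw [hcase] at hlen'; simp at hlen'
      | cons b l' => exact ⟨b, l', rfl⟩
    have htail : l' = r.drop (i * (c + 1) + 1) := by
      rw [← List.drop_drop, ← hl, hbl]; rfl
    have hw : (l'.take c).length = c := by
      rw [List.length_take]; rw [hbl] at hlen'; simp at hlen'; omega
    have hdec : l = b :: (l'.take c ++ l'.drop c) := by rw [List.take_append_drop]; exact hbl
    rw [hdec] at hi
    obtain ⟨h1, h2⟩ := ticket_false_of_run4_cons hw hi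
    refine ⟨by rw [← htail]; exact h1, ?_⟩
    have : l'.drop c = r.drop ((i + 1) * (c + 1)) := by
      rw [htail, List.drop_drop]; congr 1; ring
    rwa [this] at h2
  intro i
  induction i with
  | zero =>
    intro hlen
    obtain ⟨h1, h2⟩ := step 0 (by simpa using hr0) hlen
    exact ⟨fun i' hi' => by rw [Nat.le_zero.1 hi']; exact h1, h2⟩
  | succ i ih =>
    intro hlen
    obtain ⟨hall, hrun⟩ := ih (le_trans (Nat.mul_le_mul_right _ (Nat.le_succ _)) hlen)
    obtain ⟨h1, h2⟩ := step (i + 1) hrun hlen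
    refine ⟨fun i' hi' => ?_, h2⟩
    rcases Nat.lt_or_ge i' (i + 1) with h | h
    · exact hall i' (by omega)
    · rw [show i' = i + 1 by omega]; exact h1

/-- **The failure count of the whole algorithm**: with `R` complete rounds fitting into the `m`
coins (`R (cpt + 1) ≤ m`), `#{run4 = false} ≤ (2 · #{ticket fails})^R · 2^(m - R(cpt+1))` —
tickets read disjoint coin blocks. [cite: SchoeningFOCS1999, Theorem (proof: independent repetitions)] -/
theorem cnt_run4_false_le {R m : ℕ} (hm : R * (cpt φ d S + 1) ≤ m) :
    cnt m {r | run4 φ d S r = false} ≤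
      (2 * cnt (cpt φ d S) {w | (ticket φ d S w).1 = false}) ^ R * 2 ^ (m - R * (cpt φ d S + 1)) := by
  set c := cpt φ d S with hc
  set B := c + 1 with hB
  set OK : Set (List Bool) := {y | (ticket φ d S ((y.drop 1).take c)).1 = false} with hOK
  set E : Set (List Bool) := {y | ∀ i < R, (y.drop (i * B)).take B ∈ OK} with hE
  -- (i) a failing run has all its blocks in `OK`
  have h1 : cnt m {r | run4 φ d S r = false} ≤ cnt m E := by
    refine cnt_mono_set fun r hr hrun => ?_
    simp only [hE, hOK, Set.mem_setOf_eq] at hrun ⊢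
    intro i hi
    have hR : (R - 1 + 1) * B ≤ r.length := by rw [hr, Nat.sub_add_cancel (by omega)]; exact hm
    have := (tickets_false_of_run4 hrun (R - 1) hR).1 i (by omega)
    rw [List.drop_take, List.drop_drop, List.take_take, show min c (B - 1) = c by omega]
    exact this
  -- (ii) `E` only looks at the first `R B` coins
  have h2 : cnt m E = cnt (R * B) E * 2 ^ (m - R * B) := by
    obtain ⟨t, rfl⟩ : ∃ t, m = R * B + t := ⟨m - R * B, by omega⟩
    rw [Nat.add_sub_cancel_left, ← cnt_take]
    refine cnt_congr fun y _ => ?_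
    simp only [hE, Set.mem_setOf_eq]
    refine forall₂_congr fun i hi => ?_
    rw [List.drop_take, List.take_take, show min B (R * B - i * B) = B by
      rw [← Nat.sub_mul]; exact Nat.min_eq_left (Nat.le_mul_of_pos_left B (by omega))]
  -- (iii) the blocks are independent, (iv) the ticket coin is free
  have h3 : cnt (R * B) E = cnt B OK ^ R := cnt_blocks B OK R
  have h4 : cnt B OK = 2 * cnt c {w | (ticket φ d S w).1 = false} := by
    rw [hB, cnt_succ, two_mul]
    congr 1 <;> exact cnt_congr fun y hy => by
      simp only [hOK, Set.mem_setOf_eq, List.drop_succ_cons, List.drop_zero, List.take_of_length_le hy.le]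
  calc cnt m {r | run4 φ d S r = false} ≤ cnt m E := h1
    _ = _ := by rw [h2, h3, h4]

end Run

/-! ### Success probability at least `2/3` from a per-ticket bound -/

/-- **From one ticket to the whole algorithm.** If the coin string of length `m` accommodates `R`
complete tickets (`R (cpt + 1) ≤ m`) and `R · #{ticket succeeds} ≥ 2 · 2^cpt` (i.e. `R ≥ 2/σ` for
the success probability `σ` of one ticket), then `run4` accepts with probability at least `2/3`.
[cite: SchoeningFOCS1999, Theorem (proof: `t = O(1/σ)` independent repetitions succeed with constant probability); HofmeisterEtAl2002, §3] -/
theorem uniformProb_run4_ge (φ : KCNF k) (d S : ℕ) {R m : ℕ} (hm : R * (cpt φ d S + 1) ≤ m)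
    (hR : 2 * 2 ^ cpt φ d S ≤ R * cnt (cpt φ d S) {w | (ticket φ d S w).1 = true}) :
    (2 : ℝ) / 3 ≤ uniformProb m {r | run4 φ d S r = true} := by
  set c := cpt φ d S with hc
  set s := cnt c {w | (ticket φ d S w).1 = true} with hs
  set f := cnt c {w | (ticket φ d S w).1 = false} with hf
  have hrun : cnt m {r | run4 φ d S r = false} ≤ (2 * f) ^ R * 2 ^ (m - R * (c + 1)) := cnt_run4_false_le hm
  have hsf : s + f = 2 ^ c := by
    rw [hs, hf, ← cnt_add_cnt_compl c {w | (ticket φ d S w).1 = true}]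
    congr 1
    exact cnt_congr fun y _ => by simp
  -- to the reals
  have h2c : (0 : ℝ) < 2 ^ c := by positivity
  set σ₀ : ℝ := (s : ℝ) / 2 ^ c with hσ₀
  have hσ₀0 : 0 ≤ σ₀ := by rw [hσ₀]; positivity
  have hσ₁ : σ₀ ≤ 1 := by
    rw [hσ₀, div_le_one h2c]
    have : ((s : ℕ) : ℝ) ≤ ((2 ^ c : ℕ) : ℝ) := by exact_mod_cast (hsf ▸ Nat.le_add_right s f)
    push_cast at this
    exact this
  have hRσ : (2 : ℝ) ≤ R * σ₀ := by
    rw [hσ₀, ← mul_div_assoc, le_div_iff₀ h2c]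
    have : ((2 * 2 ^ c : ℕ) : ℝ) ≤ ((R * s : ℕ) : ℝ) := by exact_mod_cast hR
    push_cast at this
    linarith
  have hthird := one_sub_pow_le_third hσ₀0 hσ₁ hRσ
  -- the failure probability
  have hfx : (f : ℝ) / 2 ^ c = 1 - σ₀ := by
    have : (f : ℝ) = 2 ^ c - s := by
      have : ((s + f : ℕ) : ℝ) = ((2 ^ c : ℕ) : ℝ) := by rw [hsf]
      push_cast at this; linarith
    rw [this, sub_div, div_self h2c.ne', hσ₀]
  have hfail : uniformProb m {r | run4 φ d S r = false} ≤ 1 / 3 := by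
    rw [uniformProb_eq_cnt_div, div_le_iff₀ (by positivity)]
    have hcast : (cnt m {r | run4 φ d S r = false} : ℝ) ≤ (2 * f) ^ R * 2 ^ (m - R * (c + 1)) := by
      exact_mod_cast hrun
    refine hcast.trans ?_
    obtain ⟨t, rfl⟩ : ∃ t, m = R * (c + 1) + t := ⟨m - R * (c + 1), by omega⟩
    rw [Nat.add_sub_cancel_left, pow_add, pow_mul, pow_succ]
    have hx : ((2 : ℝ) * f) ^ R ≤ (1 / 3) * (2 ^ c * 2) ^ R := by
      have hle : (2 : ℝ) * f = (1 - σ₀) * (2 ^ c * 2) := by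
        have : (f : ℝ) = (1 - σ₀) * 2 ^ c := by rw [← hfx, div_mul_cancel₀ _ h2c.ne']
        rw [this]; ring
      calc ((2 : ℝ) * f) ^ R = ((1 - σ₀) * (2 ^ c * 2)) ^ R := by rw [hle]
        _ = (1 - σ₀) ^ R * (2 ^ c * 2) ^ R := mul_pow _ _ _
        _ ≤ _ := mul_le_mul_of_nonneg_right hthird (by positivity)
    calc ((2 : ℝ) * f) ^ R * 2 ^ t ≤ (1 / 3) * (2 ^ c * 2) ^ R * 2 ^ t :=
          mul_le_mul_of_nonneg_right hx (by positivity)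
      _ = _ := by ring
  have hcompl : {r : List Bool | run4 φ d S r = true} = {r | run4 φ d S r = false}ᶜ := by
    ext r; simp
  rw [hcompl, uniformProb_compl]
  linarith

end Literature.Computability.FineGrained.SchoeningFour
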